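import Literature.NumberTheory.Sieve.MontgomeryVaughan1975Decomposition
import Literature.NumberTheory.LFunctions.LogFreeDensityTheorem14Zeta
import Literature.NumberTheory.LFunctions.DeuringHeilbronnTwoModuli
import Literature.NumberTheory.Sieve.MontgomeryVaughan1975Zeros
import Literature.NumberTheory.DiophantineGeometry.NamedHypothesesProofs
import HarnessLib

/-!
# Gallagher's log-free density estimate with the Deuring–Heilbronn factor — DISCHARGED;
# hence Gallagher's Theorem 7 (Montgomery–Vaughan 1975, Lemma 4.3), (8.3), and
# THEOREM 1 of Montgomery–Vaughan 1975 (the exceptional set in Goldbach's problem, parity.S15)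

Topic `Literature/NumberTheory/Sieve`. THEOREMS only (no definition, no named fact, no `sorry`).
Reproduction of published work: P. X. Gallagher, *A large sieve density estimate near `σ = 1`*,
Invent. Math. 11 (1970) 329–339, Theorems 6 and 7; E. Bombieri, *Le grand crible dans la théorie
analytique des nombres*, Astérisque 18 (1987), §6, Théorème 14 (both assertions); H. L. Montgomery,
R. C. Vaughan, *The exceptional set in Goldbach's problem*, Acta Arith. 27 (1975) 353–370, Lemma 4.3,
(8.3) and Theorem 1.

The named fact `MontgomeryVaughan1975.gallagher1970_logFreeDensity` (child 3 of the tree's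
decomposition of Montgomery–Vaughan's paper, `MontgomeryVaughan1975Decomposition.lean`) packages four
zero-density binders at the height `T = P⁶`: the plain log-free bounds for `ζ` and for the primitive
characters of modulus `≤ P` (Bombieri's Théorème 14, first assertion — PROVED in the tree:
`LogFreeDensity.logFreeDensity_zeta`, `LogFreeDensity.logFreeDensity_dirichlet`), and the same two
bounds improved by the factor `(1 − β̃) log P` in the presence of an exceptional zero `β̃` (Théorème 14,
second assertion).  This file PROVES the fact.  The two Deuring–Heilbronn binders are obtained from the
plain ones and the Deuring–Heilbronn PHENOMENON itself (tree: rh.S33 `deuring_heilbronn`, discharged as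
`deuring_heilbronn_holds`; two-moduli form `DeuringHeilbronnTwoModuli.deuring_heilbronn_twoModuli`) by
the following elementary conversion (Bombieri, p. 52, "d'où le résultat"; Iwaniec, *Conversations*,
§9 (9.5)–(9.6) read backwards):

* every zero `ρ ≠ β̃` of `ζ` or of a primitive `L(s, χ)`, `q ≤ P`, with `|γ| ≤ P⁶` satisfies
  `1 − Re ρ ≥ η₀ := c₂ log(c₁/(9 δ̃ log P))/(9 log P)`, `δ̃ = 1 − β̃` (Deuring–Heilbronn at the modulus
  `r̃ q ≤ P²`, `log(r̃ q (2 + |γ|)) ≤ 9 log P`, and monotonicity of `u ↦ log(c₁/(δ̃u))/u`);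
* hence for `1 − α < η₀` the zero count above `α` is ZERO, and for `1 − α ≥ η₀`,
  `P^{c(1−α)} = P^{(c + 9/c₂)(1−α)} · P^{−(9/c₂)(1−α)} ≤ P^{(c + 9/c₂)(1−α)} · 9 δ̃ log P/c₁`
  because `P^{(9/c₂) η₀} = c₁/(9 δ̃ log P)` exactly;
* the point `β̃` itself is not a zero of the other primitive `L`-functions (Landau–Page, tree:
  `MontgomeryVaughan1975.exists_exceptionalZero_unique`, which also gives `χ̃² = χ₀`), and the zeros of
  `ζ` in the tree's index `weilZeroIndex` are non-real with `0 < Re ρ < 1`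
  (`DiophantineGeometry.re_pos_of_riemannZeta_eq_zero`, `re_lt_one_of_riemannZeta_eq_zero`).

No lower bound for `δ̃` (Siegel) is needed: the repulsion `η₀` encodes `δ̃`.

Main results:
* `MontgomeryVaughan1975.gallagher1970_logFreeDensity_holds` — the named fact, discharged;
* `MontgomeryVaughan1975.lemma43_gallagher_holds` — **Gallagher's Theorem 7 / Montgomery–Vaughan's
  LEMMA 4.3** (named fact `lemma43_gallagher`), by the tree's glue `lemma43_gallagher_holds_of` with the
  explicit formulae `truncatedExplicitFormula_psiChar_holds`, `truncatedExplicitFormula_psi_holds`;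
* `MontgomeryVaughan1975.majorArc_lowerBound_holds` — (8.3) of Montgomery–Vaughan (named fact);
* `Literature.NumberTheory.Sieve.goldbachExceptionalCount_isBigO_rpow_holds` — **THEOREM 1 of
  Montgomery–Vaughan 1975** (parity.S15): there is `δ > 0` with `E(X) ≪ X^{1−δ}`, `E(X)` the number of
  even `N ≤ X`, `N ≥ 4`, that are not a sum of two primes.  Unconditional; every input is a theorem of
  the tree.

## References

* [Gallagher1970Density] P. X. Gallagher, Invent. Math. 11 (1970) 329–339, Theorems 6, 7.
* [Bombieri1987GrandCrible] E. Bombieri, Astérisque 18 (1987), §6, Théorème 14 (pp. 48–52).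
* [MontgomeryVaughanActa1975] H. L. Montgomery, R. C. Vaughan, Acta Arith. 27 (1975) 353–370,
  Lemma 4.3, (8.3), Theorem 1.
* [IwaniecConversations2006] H. Iwaniec, *Conversations on the exceptional character*, LNM 1891
  (2006), §9.
-/

noncomputable section

open Complex Finset Real

namespace Literature.NumberTheory.Sieve.MontgomeryVaughan1975

open Literature.NumberTheory.LFunctions Literature.NumberTheory.LFunctions.DirichletDisc
  Literature.NumberTheory.LFunctions.DeuringHeilbronnTwoModuli
  Literature.NumberTheory.DiophantineGeometry

/-! ### Two real-variable lemmas -/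

/-- Monotonicity of the Deuring–Heilbronn repulsion in the logarithm: for `0 < u ≤ U` and
`δ U ≤ c` (`δ > 0`), `log(c/(δU))/U ≤ log(c/(δu))/u`. [folklore] -/
theorem log_div_div_le_of_le {c δ u U : ℝ} (hu : 0 < u) (huU : u ≤ U) (hδ : 0 < δ)
    (hδU : δ * U ≤ c) : Real.log (c / (δ * U)) / U ≤ Real.log (c / (δ * u)) / u := by
  have hU : 0 < U := lt_of_lt_of_le hu huU
  have hc : 0 < c := lt_of_lt_of_le (mul_pos hδ hU) hδU
  have hcδ : 0 < c / δ := div_pos hc hδ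
  -- `log(c/(δ v)) = log(c/δ) − log v`
  have hsplit : ∀ v : ℝ, 0 < v → Real.log (c / (δ * v)) = Real.log (c / δ) - Real.log v := by
    intro v hv
    rw [show c / (δ * v) = (c / δ) / v by rw [div_div], Real.log_div hcδ.ne' hv.ne']
  rw [hsplit U hU, hsplit u hu, div_le_div_iff₀ hU hu]
  -- `log(c/δ) ≥ log U ≥ log u`
  have hL : Real.log U ≤ Real.log (c / δ) := by
    refine Real.log_le_log hU ?_
    rw [le_div_iff₀ hδ]; linarith [mul_comm δ U]
  have hlu : Real.log u ≤ Real.log U := Real.log_le_log hu huU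
  nlinarith [mul_le_mul_of_nonneg_left hlu hU.le, mul_nonneg (sub_nonneg.2 huU) (sub_nonneg.2 hL)]

/-- The conversion factor: if `η₀ = c₂ log(c₁/(δU))/U` with `U = 9 log P`, `0 < δU ≤ c₁`, then for
`1 − α ≥ η₀`, `P^{a(1−α)} ≤ (δ U/c₁) · P^{(a + 9/c₂)(1−α)}` (`P > 1`). [folklore] -/
theorem rpow_le_repulsionFactor_mul_rpow {P a c₁ c₂ δ α : ℝ} (hP : 1 < P) (hc₂ : 0 < c₂)
    (hδ : 0 < δ) (hδU : δ * (9 * Real.log P) ≤ c₁)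
    (hα : c₂ * Real.log (c₁ / (δ * (9 * Real.log P))) / (9 * Real.log P) ≤ 1 - α) :
    P ^ (a * (1 - α)) ≤ δ * (9 * Real.log P) / c₁ * P ^ ((a + 9 / c₂) * (1 - α)) := by
  have hP0 : 0 < P := by linarith
  have hlogP : 0 < Real.log P := Real.log_pos hP
  set U : ℝ := 9 * Real.log P with hU
  have hU0 : 0 < U := by positivity
  have hc₁ : 0 < c₁ := lt_of_lt_of_le (mul_pos hδ hU0) hδU
  have hq : 0 < c₁ / (δ * U) := div_pos hc₁ (mul_pos hδ hU0)
  -- `P^{(9/c₂) η₀} = c₁/(δU)`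
  have hkey : P ^ ((9 / c₂) * (c₂ * Real.log (c₁ / (δ * U)) / U)) = c₁ / (δ * U) := by
    rw [Real.rpow_def_of_pos hP0]
    have : Real.log P * (9 / c₂ * (c₂ * Real.log (c₁ / (δ * U)) / U)) = Real.log (c₁ / (δ * U)) := by
      rw [hU]; field_simp
    rw [this, Real.exp_log hq]
  have hmono : c₁ / (δ * U) ≤ P ^ ((9 / c₂) * (1 - α)) := by
    rw [← hkey]
    exact Real.rpow_le_rpow_of_exponent_le hP.le (mul_le_mul_of_nonneg_left hα (by positivity))
  have hsplit : P ^ ((a + 9 / c₂) * (1 - α)) = P ^ (a * (1 - α)) * P ^ ((9 / c₂) * (1 - α)) := by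
    rw [← Real.rpow_add hP0]; ring_nf
  rw [hsplit]
  have hpos : 0 < P ^ (a * (1 - α)) := Real.rpow_pos_of_pos hP0 _
  -- `1 ≤ (δU/c₁) · P^{(9/c₂)(1−α)}`
  have h1 : 1 ≤ δ * U / c₁ * P ^ ((9 / c₂) * (1 - α)) := by
    have := mul_le_mul_of_nonneg_left hmono (show 0 ≤ δ * U / c₁ by positivity)
    have e : δ * U / c₁ * (c₁ / (δ * U)) = 1 := by field_simp
    linarith
  calc P ^ (a * (1 - α)) = P ^ (a * (1 - α)) * 1 := (mul_one _).symm
    _ ≤ P ^ (a * (1 - α)) * (δ * U / c₁ * P ^ ((9 / c₂) * (1 - α))) :=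
        mul_le_mul_of_nonneg_left h1 hpos.le
    _ = δ * U / c₁ * (P ^ (a * (1 - α)) * P ^ ((9 / c₂) * (1 - α))) := by ring

/-- `P(2 + P⁶) ≤ P⁹` and `P²(2 + P⁶) ≤ P⁹` for `P ≥ 2`, hence `log(m(2 + |t|)) ≤ 9 log P` for
`m ≤ P²`, `|t| ≤ P⁶`. [folklore] -/
theorem log_modulus_height_le {P m t : ℝ} (hP : 2 ≤ P) (hm0 : 1 ≤ m) (hm : m ≤ P ^ 2)
    (ht : |t| ≤ P ^ 6) : 0 < Real.log (m * (2 + |t|)) ∧ Real.log (m * (2 + |t|)) ≤ 9 * Real.log P := by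
  have hP0 : 0 < P := by linarith
  have habs : 0 ≤ |t| := abs_nonneg t
  refine ⟨Real.log_pos (by nlinarith), ?_⟩
  rw [← Real.log_rpow hP0, Real.log_le_log_iff (by nlinarith) (Real.rpow_pos_of_pos hP0 _)]
  have h9 : P ^ (9 : ℝ) = P ^ 2 * P ^ 6 * P := by
    rw [show (9 : ℝ) = (9 : ℕ) by norm_num, Real.rpow_natCast]; ring
  rw [h9]
  have hP6 : (64 : ℝ) ≤ P ^ 6 := by
    have h := pow_le_pow_left₀ (by norm_num : (0:ℝ) ≤ 2) hP 6
    norm_num at h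
    exact h
  have hP6P : P ^ 6 * 2 ≤ P ^ 6 * P := mul_le_mul_of_nonneg_left hP (by positivity)
  calc m * (2 + |t|) ≤ P ^ 2 * (2 + P ^ 6) := by
        apply mul_le_mul hm (by linarith) (by positivity) (by positivity)
    _ ≤ P ^ 2 * (P ^ 6 * P) := by
        apply mul_le_mul_of_nonneg_left _ (by positivity)
        linarith
    _ = P ^ 2 * P ^ 6 * P := by ring

/-! ### The Deuring–Heilbronn binders from the plain ones -/

open scoped Classical in
/-- **Gallagher's log-free density estimate with the Deuring–Heilbronn factor — DISCHARGED**
(named fact `gallagher1970_logFreeDensity`, child 3 of the decomposition of Montgomery–Vaughan 1975).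
The plain binders are Bombieri's Théorème 14, first assertion (`logFreeDensity_zeta`,
`logFreeDensity_dirichlet`); the binders with the factor `(1 − β̃) log P` follow from them and the
Deuring–Heilbronn phenomenon (`deuring_heilbronn_twoModuli`) by the conversion described in the module
docstring, the point `β̃` being excluded from the other `L`-functions by Landau–Page
(`exists_exceptionalZero_unique`). [cite: Gallagher1970Density, Theorem 6]
[cite: Bombieri1987GrandCrible, §6 Théorème 14] -/
theorem gallagher1970_logFreeDensity_holds : gallagher1970_logFreeDensity := by
  obtain ⟨c₁, c₂, hc₁, hc₂, hDH⟩ := deuring_heilbronn_twoModuli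
  obtain ⟨cU, hcU, hU⟩ := exists_exceptionalZero_unique
  obtain ⟨aζ, Aζ, haζ, hAζ, hζ⟩ := LogFreeDensity.logFreeDensity_zeta
  obtain ⟨aχ, Aχ, haχ, hAχ, hχ⟩ := LogFreeDensity.logFreeDensity_dirichlet
  -- shared constants
  set a : ℝ := max aζ aχ with ha
  set A : ℝ := max Aζ Aχ with hA
  have ha0 : 0 < a := lt_max_of_lt_left haζ
  have hA0 : 0 < A := lt_max_of_lt_left hAζ
  set cD : ℝ := a + 9 / c₂ with hcD
  set CD : ℝ := max A (9 * A / c₁) with hCD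
  set cH : ℝ := min (c₁ / 18) (cU / 4) with hcH
  have hcD0 : 0 < cD := by positivity
  have hCD0 : 0 < CD := lt_max_of_lt_left hA0
  have hcH0 : 0 < cH := by positivity
  have hACD : A ≤ CD := le_max_left _ _
  -- the plain bounds with the shared constants
  have plain_mono : ∀ {P α S a' A' : ℝ}, 2 ≤ P → α ≤ 1 → a' ≤ a → 0 ≤ A' → A' ≤ A →
      S ≤ A' * P ^ (a' * (1 - α)) → S ≤ A * P ^ (a * (1 - α)) := by
    intro P α S a' A' hP hα1 ha' hA'0 hA' hS
    have hP1 : (1 : ℝ) ≤ P := by linarith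
    refine hS.trans (mul_le_mul hA' (Real.rpow_le_rpow_of_exponent_le hP1
      (mul_le_mul_of_nonneg_right ha' (by linarith))) (Real.rpow_nonneg (by linarith) _) hA0.le)
  have plain_to_CD : ∀ {P α S : ℝ}, 2 ≤ P → α ≤ 1 → S ≤ A * P ^ (a * (1 - α)) →
      S ≤ CD * P ^ (cD * (1 - α)) := by
    intro P α S hP hα1 hS
    have hP1 : (1 : ℝ) ≤ P := by linarith
    refine hS.trans (mul_le_mul hACD (Real.rpow_le_rpow_of_exponent_le hP1
      (mul_le_mul_of_nonneg_right (by rw [hcD]; linarith [div_pos (by norm_num : (0:ℝ) < 9) hc₂])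
        (by linarith))) (Real.rpow_nonneg (by linarith) _) hCD0.le)
  -- facts about an exceptional zero at level `cH`
  have exc_facts : ∀ {P : ℝ} (hP : 2 ≤ P) {r : ℕ} [NeZero r] {χe : DirichletCharacter ℂ r} {β : ℝ},
      IsExceptionalZero cH P r χe β →
        χe ^ 2 = 1 ∧ 0 < 1 - β ∧ (1 - β) * (9 * Real.log P) ≤ c₁ ∧
          (1 - β) * (9 * Real.log P) ≤ c₁ / 2 ∧ 1 - cU / Real.log (P ^ 2) < β := by
    intro P hP r _ χe β hex
    obtain ⟨_, hne1, hrP, hβlow, hβ1, hLβ⟩ := hex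
    have hP1 : (1 : ℝ) < P := by linarith
    have hlogP : 0 < Real.log P := Real.log_pos hP1
    have hδlog : (1 - β) * Real.log P ≤ cH := by
      have h1 : cH / Real.log P ≥ 1 - β := by linarith
      rwa [ge_iff_le, le_div_iff₀ hlogP] at h1
    have hcH1 : cH ≤ c₁ / 18 := min_le_left _ _
    have hcH2 : cH ≤ cU / 4 := min_le_right _ _
    have h9 : (1 - β) * (9 * Real.log P) ≤ c₁ / 2 := by
      have e : (1 - β) * (9 * Real.log P) = 9 * ((1 - β) * Real.log P) := by ring
      rw [e]; linarith
    have hβU : 1 - cU / Real.log (P ^ 2) < β := by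
      rw [Real.log_pow]; push_cast
      have h1 : cH / Real.log P < cU / (2 * Real.log P) := by
        rw [div_lt_div_iff₀ hlogP (by positivity)]
        have h2 : 2 * cH < cU := by linarith
        have h3 := mul_lt_mul_of_pos_right h2 hlogP
        linarith
      linarith
    have hsq : χe ^ 2 = 1 := by
      have hP2 : (4 : ℝ) ≤ P ^ 2 := by nlinarith
      have hrP2 : (r : ℝ) ≤ P ^ 2 := hrP.trans (by nlinarith)
      have h := (hU (P ^ 2) hP2).1 r χe hne1 hrP2 (β : ℂ) hLβ
        (by rw [ofReal_im, abs_zero]; positivity) (by rw [ofReal_re]; exact hβU)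
      exact h.1
    exact ⟨hsq, by linarith, by linarith, h9, hβU⟩
  refine ⟨cD, CD, cH, hcD0, hCD0, hcH0, ?_, ?_, ?_, ?_⟩
  · -- binder 1: `ζ`, plain
    intro P hP α hα0 hα1
    exact plain_to_CD hP hα1 (plain_mono hP hα1 (le_max_left _ _) hAζ.le (le_max_left _ _)
      (hζ P hP α hα0 hα1))
  · -- binder 2: primitive characters, plain
    intro P hP Z hZ α hα0 hα1
    exact plain_to_CD hP hα1 (plain_mono hP hα1 (le_max_right _ _) hAχ.le (le_max_right _ _)
      (hχ P hP Z hZ α hα0 hα1))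
  · -- binder 3: `ζ`, with the Deuring–Heilbronn factor
    intro P hP r _ χe β hex α hα0 hα1
    obtain ⟨hsq, hδ, hδU, -, -⟩ := exc_facts hP hex
    obtain ⟨_, _, hrP, _, hβ1, hLβ⟩ := hex
    have hP1 : (1 : ℝ) < P := by linarith
    have hlogP : 0 < Real.log P := Real.log_pos hP1
    obtain ⟨η₀, hη₀⟩ : ∃ η₀ : ℝ,
        η₀ = c₂ * Real.log (c₁ / ((1 - β) * (9 * Real.log P))) / (9 * Real.log P) := ⟨_, rfl⟩
    -- every zero in the index is repelled
    have hrep : ∀ ρ ∈ (weilZeroIndex_finite (P ^ 6)).toFinset, ρ.re ≤ 1 - η₀ := by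
      intro ρ hρ
      obtain ⟨h0, -, -, him, hT, -⟩ := mem_toFinset_weilZeroIndex hρ
      have hre0 : 0 < ρ.re := re_pos_of_riemannZeta_eq_zero h0 him
      have hre1 : ρ.re < 1 := DiophantineGeometry.re_lt_one_of_riemannZeta_eq_zero h0
      have hne : ρ ≠ (β : ℂ) := fun h ↦ him (by rw [h, ofReal_im])
      have hL1 : (1 : DirichletCharacter ℂ 1).LFunction ρ = 0 := by
        rw [DirichletCharacter.LFunction_modOne_eq]; exact h0
      have h := hDH r 1 χe hsq β hβ1 hLβ (1 : DirichletCharacter ℂ 1) ρ hL1 hre0 hre1 hne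
      simp only [Nat.cast_one, mul_one] at h
      have hr1 : (1 : ℝ) ≤ r := by exact_mod_cast Nat.pos_of_neZero r
      have hPP2 : P ≤ P ^ 2 := by nlinarith
      obtain ⟨hℒ0, hℒU⟩ := log_modulus_height_le (m := (r : ℝ)) (t := ρ.im) hP hr1
        (hrP.trans hPP2) hT
      have hmono := log_div_div_le_of_le hℒ0 hℒU hδ hδU
      have h1 : η₀ ≤ c₂ * (Real.log (c₁ / ((1 - β) * Real.log ((r : ℝ) * (2 + |ρ.im|)))) /
          Real.log ((r : ℝ) * (2 + |ρ.im|))) := by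
        rw [hη₀, mul_div_assoc]
        exact mul_le_mul_of_nonneg_left hmono hc₂.le
      rw [mul_div_assoc] at h
      linarith
    rcases lt_or_ge (1 - α) η₀ with hlt | hge
    · -- no zero above `α`
      calc _ = (0 : ℝ) := by
            refine Finset.sum_eq_zero fun ρ hρ ↦ ?_
            rw [Finset.mem_filter] at hρ
            have := hrep ρ hρ.1
            linarith
        _ ≤ _ := mul_nonneg (mul_nonneg hCD0.le (by positivity)) (Real.rpow_nonneg (by linarith) _)
    · -- conversion of the plain bound
      have hpl := plain_mono hP hα1 (le_max_left _ _) hAζ.le (le_max_left _ _) (hζ P hP α hα0 hα1)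
      have hconv := rpow_le_repulsionFactor_mul_rpow (a := a) hP1 hc₂ hδ hδU (hη₀ ▸ hge)
      calc _ ≤ A * P ^ (a * (1 - α)) := hpl
        _ ≤ A * ((1 - β) * (9 * Real.log P) / c₁ * P ^ ((a + 9 / c₂) * (1 - α))) :=
            mul_le_mul_of_nonneg_left hconv hA0.le
        _ = 9 * A / c₁ * ((1 - β) * Real.log P) * P ^ (cD * (1 - α)) := by rw [hcD]; ring
        _ ≤ CD * ((1 - β) * Real.log P) * P ^ (cD * (1 - α)) := by
            refine mul_le_mul_of_nonneg_right (mul_le_mul_of_nonneg_right (le_max_right _ _)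
              (by positivity)) (Real.rpow_nonneg (by linarith) _)
  · -- binder 4: primitive characters, with the Deuring–Heilbronn factor
    intro P hP r _ χe β hex Z hZ α hα0 hα1
    obtain ⟨hsq, hδ, hδU, -, hβU⟩ := exc_facts hP hex
    obtain ⟨hprim_e, hne1_e, hrP, _, hβ1, hLβ⟩ := hex
    have hP1 : (1 : ℝ) < P := by linarith
    have hlogP : 0 < Real.log P := Real.log_pos hP1
    have hP2 : (4 : ℝ) ≤ P ^ 2 := by nlinarith
    have hPP2 : P ≤ P ^ 2 := by nlinarith
    obtain ⟨η₀, hη₀⟩ : ∃ η₀ : ℝ,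
        η₀ = c₂ * Real.log (c₁ / ((1 - β) * (9 * Real.log P))) / (9 * Real.log P) := ⟨_, rfl⟩
    -- every zero counted in binder 4 is repelled
    have hrep : ∀ q' ∈ Finset.Ico 1 ⌊P⌋₊, ∀ χ : DirichletCharacter ℂ (q' + 1), χ.IsPrimitive →
        ∀ ρ ∈ Z (q' + 1) χ, ¬ (q' + 1 = r ∧ (∀ n : ℕ, χ (n : ZMod (q' + 1)) = χe (n : ZMod r)) ∧
          ρ = ((β : ℝ) : ℂ)) → ρ.re ≤ 1 - η₀ := by
      intro q' hq' χ hprim ρ hρ hexcl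
      obtain ⟨hLρ, hre0, hre1, hT⟩ := hZ q' χ ρ hρ
      rw [Finset.mem_Ico] at hq'
      have hqP : ((q' + 1 : ℕ) : ℝ) ≤ P := by
        have h1 : q' + 1 ≤ ⌊P⌋₊ := hq'.2
        have h2 : ((q' + 1 : ℕ) : ℝ) ≤ (⌊P⌋₊ : ℝ) := by exact_mod_cast h1
        exact h2.trans (Nat.floor_le (by linarith))
      have hq1 : (1 : ℝ) ≤ ((q' + 1 : ℕ) : ℝ) := by exact_mod_cast Nat.succ_pos q'
      have hχne1 : χ ≠ 1 := by
        intro h1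
        have hcond := (DirichletCharacter.isPrimitive_def χ).mp hprim
        rw [h1, DirichletCharacter.conductor_one] at hcond
        omega
      -- the point `β̃` is not a zero of `L(s, χ)` unless `χ = χ̃` (Landau–Page)
      have hne : ρ ≠ (β : ℂ) := by
        intro hρβ
        rw [hρβ] at hLρ
        have h1 := (hU (P ^ 2) hP2).1 (q' + 1) χ hχne1 (hqP.trans hPP2) (β : ℂ) hLρ
          (by rw [ofReal_im, abs_zero]; positivity) (by rw [ofReal_re]; exact hβU)
        have h2 := (hU (P ^ 2) hP2).2 (q' + 1) r χ χe hχne1 hne1_e hprim hprim_e h1.1 hsq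
          (hqP.trans hPP2) (hrP.trans hPP2) β β hLρ hLβ hβU hβU
        exact hexcl ⟨h2.1, h2.2.2, hρβ⟩
      have h := hDH r (q' + 1) χe hsq β hβ1 hLβ χ ρ hLρ hre0 hre1 hne
      have hr1 : (1 : ℝ) ≤ r := by exact_mod_cast Nat.pos_of_neZero r
      have hm1 : (1 : ℝ) ≤ (r : ℝ) * ((q' + 1 : ℕ) : ℝ) := one_le_mul_of_one_le_of_one_le hr1 hq1
      have hm2 : (r : ℝ) * ((q' + 1 : ℕ) : ℝ) ≤ P ^ 2 := by
        rw [sq]; exact mul_le_mul hrP hqP (by linarith) (by linarith)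
      obtain ⟨hℒ0, hℒU⟩ := log_modulus_height_le (m := (r : ℝ) * ((q' + 1 : ℕ) : ℝ)) (t := ρ.im)
        hP hm1 hm2 hT
      have hmono := log_div_div_le_of_le hℒ0 hℒU hδ hδU
      have h1 : η₀ ≤ c₂ * (Real.log (c₁ / ((1 - β) *
          Real.log ((r : ℝ) * ((q' + 1 : ℕ) : ℝ) * (2 + |ρ.im|)))) /
            Real.log ((r : ℝ) * ((q' + 1 : ℕ) : ℝ) * (2 + |ρ.im|))) := by
        rw [hη₀, mul_div_assoc]
        exact mul_le_mul_of_nonneg_left hmono hc₂.le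
      rw [mul_div_assoc] at h
      linarith
    rcases lt_or_ge (1 - α) η₀ with hlt | hge
    · -- no zero above `α`
      calc _ = (0 : ℝ) := by
            refine Finset.sum_eq_zero fun q' hq' ↦ Finset.sum_eq_zero fun χ hχ ↦
              Finset.sum_eq_zero fun ρ hρ ↦ ?_
            rw [Finset.mem_filter] at hχ hρ
            have := hrep q' hq' χ hχ.2 ρ hρ.1 hρ.2.2
            linarith [hρ.2.1]
        _ ≤ _ := mul_nonneg (mul_nonneg hCD0.le (by positivity)) (Real.rpow_nonneg (by linarith) _)
    · -- drop the exclusion, then convert the plain bound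
      have hpl := plain_mono hP hα1 (le_max_right _ _) hAχ.le (le_max_right _ _)
        (hχ P hP Z hZ α hα0 hα1)
      have hconv := rpow_le_repulsionFactor_mul_rpow (a := a) hP1 hc₂ hδ hδU (hη₀ ▸ hge)
      refine le_trans ?_ (hpl.trans ?_)
      · refine Finset.sum_le_sum fun q' _ ↦ Finset.sum_le_sum fun χ _ ↦
          Finset.sum_le_sum_of_subset_of_nonneg ?_ (fun _ _ _ ↦ Nat.cast_nonneg _)
        intro ρ hρ
        rw [Finset.mem_filter] at hρ ⊢
        exact ⟨hρ.1, hρ.2.1⟩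
      calc A * P ^ (a * (1 - α))
            ≤ A * ((1 - β) * (9 * Real.log P) / c₁ * P ^ ((a + 9 / c₂) * (1 - α))) :=
            mul_le_mul_of_nonneg_left hconv hA0.le
        _ = 9 * A / c₁ * ((1 - β) * Real.log P) * P ^ (cD * (1 - α)) := by rw [hcD]; ring
        _ ≤ CD * ((1 - β) * Real.log P) * P ^ (cD * (1 - α)) := by
            refine mul_le_mul_of_nonneg_right (mul_le_mul_of_nonneg_right (le_max_right _ _)
              (by positivity)) (Real.rpow_nonneg (by linarith) _)

/-! ### Consequences: Lemma 4.3, (8.3), and Theorem 1 of Montgomery–Vaughan 1975 -/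

/-- **Gallagher's Theorem 7, as modified by Montgomery–Vaughan (LEMMA 4.3) — DISCHARGED**: the named
fact `lemma43_gallagher` holds.  The tree's glue `lemma43_gallagher_holds_of` fed with the explicit
formulae (`truncatedExplicitFormula_psiChar_holds`, `truncatedExplicitFormula_psi_holds`, MV Thm 12.10 /
12.5) and `gallagher1970_logFreeDensity_holds`. [cite: MontgomeryVaughanActa1975, §4 Lemma 4.3]
[cite: Gallagher1970Density, Theorem 7] -/
theorem lemma43_gallagher_holds : lemma43_gallagher :=
  lemma43_gallagher_holds_of truncatedExplicitFormula_psiChar_holds truncatedExplicitFormula_psi_holds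
    gallagher1970_logFreeDensity_holds

/-- **(8.3) of Montgomery–Vaughan 1975 — DISCHARGED**: the named fact `majorArc_lowerBound` (the
major-arc lower bound `R₁(n) > X P^{-1/3}` with its exception count) holds.
[cite: MontgomeryVaughanActa1975, §8 (8.3)] -/
theorem majorArc_lowerBound_holds : majorArc_lowerBound :=
  majorArc_lowerBound_holds_of truncatedExplicitFormula_psiChar_holds truncatedExplicitFormula_psi_holds
    gallagher1970_logFreeDensity_holds

end Literature.NumberTheory.Sieve.MontgomeryVaughan1975

namespace Literature.NumberTheory.Sieve

open MontgomeryVaughan1975 Literature.NumberTheory.LFunctions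

/-- **THEOREM 1 of Montgomery–Vaughan 1975 (parity.S15) — DISCHARGED**: there is `δ > 0` such that
the number `E(X)` of even `N ≤ X`, `N ≥ 4`, which are not a sum of two primes is `O(X^{1−δ})`.
Unconditional: the circle method with Gallagher's prime number theorem off the exceptional character
and the Deuring–Heilbronn phenomenon, every input a theorem of the tree
(`goldbachExceptionalCount_isBigO_rpow_holds_of` with `gallagher1970_logFreeDensity_holds`).
[cite: MontgomeryVaughanActa1975, Theorem 1] -/
theorem goldbachExceptionalCount_isBigO_rpow_holds : goldbachExceptionalCount_isBigO_rpow :=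
  goldbachExceptionalCount_isBigO_rpow_holds_of truncatedExplicitFormula_psiChar_holds
    truncatedExplicitFormula_psi_holds gallagher1970_logFreeDensity_holds

end Literature.NumberTheory.Sieve


namespace Literature.NumberTheory.Sieve.MontgomeryVaughan1975

/-- **The major-arc formulae (6.17), (6.1͂7), (7.1) of Montgomery–Vaughan 1975 — DISCHARGED** (named
fact `majorArc_formulae`; Brüdern–Perelli 1998, §4, Lemmas 2–3): the tree's reduction
`majorArc_formulae_of_lemma43_gallagher` fed with `lemma43_gallagher_holds` and the PROVED §6
(`section6_formulae_holds`). [cite: MontgomeryVaughanActa1975, §6 (6.17) and §7 (7.1)] -/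
theorem majorArc_formulae_holds : majorArc_formulae :=
  majorArc_formulae_of_lemma43_gallagher lemma43_gallagher_holds ⟨1, one_pos, section6_formulae_holds 1⟩

end Literature.NumberTheory.Sieve.MontgomeryVaughan1975

end
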